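import Mathlib
import Literature.Computability.AlgebraicComplexity.FastFourierTransform
import Literature.Computability.AlgebraicComplexity.DivisionSLP
import Literature.LinearAlgebra.Matrix.CauchyLike

/-!
# Toeplitz-like to Cauchy-like conversion, II: twisted DFT matrices and the cost of the transforms

Helper file for the stub `stub_conversion` of the crux `HiddenToeplitzCorners.ToeplitzLikeDetCost`
(stmt-MatrixMultiplication-7491), line `Sketch`: the twisted DFT matrices `V_ε = (ε^j ω^{ij})`
(Vandermonde on the coset `ε⟨ω⟩`, hence invertible; explicit inverse of `V_φᵀ` by the reversed
DFT), their columns as DFTs, the passage from the intertwining relations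
`D_x V_ε = V_ε Z_e`, `D_y V_φ = V_φ Z_f` and a Sylvester displacement `Z_e T - T Z_f = G Hᵀ` to the
Cauchy-like matrix `V_ε T V_φ⁻¹` (Heinig 1995; Pan 2001, §4.7), and the operation count of the
two transforms `V_ε G`, `(V_φᵀ)⁻¹ H` by FFTs in the `Derivable` model.

Target tree file:
`Summits/MatrixMultiplication/MatrixMultiplication/Theorems/HiddenToeplitzCornersToeplitzLikeDetCostConversionAuxDFT.lean`
(helper for the crux, landed with `--supports stmt-MatrixMultiplication-7491`).
-/

set_option linter.dupNamespace false

namespace Summit.MatrixMultiplication.MatrixMultiplication.Theorems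

open scoped BigOperators Matrix
open Literature.Computability.AlgebraicComplexity Literature.LinearAlgebra.Matrix

section TwistedDFT

variable {K : Type*} [Field K]

/-- `2^κ = 2^(κ-1) · 2` for `κ ≠ 0` (the radix-2 split behind `ω^(2^(κ-1)) = -1`). [folklore] -/
theorem conv_two_pow_eq (κ : ℕ) (hκ : κ ≠ 0) : 2 ^ κ = 2 ^ (κ - 1) * 2 := by
  rw [← pow_succ, Nat.sub_add_cancel (Nat.one_le_iff_ne_zero.2 hκ)]

/-- A primitive root of unity in a field is a principal root of unity. [folklore] -/
theorem conv_isPrincipalRoot_of_isPrimitiveRoot {n : ℕ} {ω : K} (hω : IsPrimitiveRoot ω n) :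
    IsPrincipalRoot n ω := by
  refine ⟨hω.pow_eq_one, fun m hm0 hmn => ?_⟩
  have hne : ω ^ m ≠ 1 := hω.pow_ne_one_of_pos_of_lt hm0.ne' hmn
  have h1 : (∑ i ∈ Finset.range n, (ω ^ m) ^ i) * (ω ^ m - 1) = (ω ^ m) ^ n - 1 :=
    geom_sum_mul _ _
  rw [← pow_mul, mul_comm m n, pow_mul, hω.pow_eq_one, one_pow, sub_self] at h1
  have h2 : ∑ i ∈ Finset.range n, (ω ^ m) ^ i = 0 :=
    (mul_eq_zero.1 h1).resolve_right (sub_ne_zero.2 hne)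
  rw [← h2]
  exact Finset.sum_congr rfl fun i _ => by rw [← pow_mul, mul_comm]

/-- The twisted DFT matrix `(ε^j ω^{ij})` is the Vandermonde matrix on the nodes `ε ω^i`, hence
invertible for `ε ≠ 0` and `ω` a primitive `n`-th root of unity. [folklore] -/
theorem conv_isUnit_det_twistedDFT {n : ℕ} {ε ω : K} (hε : ε ≠ 0) (hω : IsPrimitiveRoot ω n) :
    IsUnit (Matrix.of fun i j : Fin n => ε ^ (j : ℕ) * ω ^ ((i : ℕ) * j)).det := by
  have hV : (Matrix.of fun i j : Fin n => ε ^ (j : ℕ) * ω ^ ((i : ℕ) * j)) =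
      Matrix.vandermonde fun i : Fin n => ε * ω ^ (i : ℕ) := by
    ext i j
    simp only [Matrix.of_apply, Matrix.vandermonde_apply, mul_pow, ← pow_mul]
  rw [hV, isUnit_iff_ne_zero, Matrix.det_vandermonde_ne_zero_iff]
  intro i j hij
  exact Fin.ext (hω.pow_inj i.isLt j.isLt (mul_left_cancel₀ hε hij))

/-- **Explicit inverse of the transposed twisted DFT** (inverse DFT = reversed DFT divided by `n`):
`((φ^i ω^{ij})ᵢⱼ)⁻¹ = (n⁻¹ φ^{-j} ω^{j (n-i)})ᵢⱼ`. [folklore] -/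
theorem conv_twistedDFT_transpose_inv {n : ℕ} [NeZero n] {φ ω : K} (hφ : φ ≠ 0)
    (hω : IsPrimitiveRoot ω n) (hn : (n : K) ≠ 0) :
    ((Matrix.of fun i j : Fin n => φ ^ (j : ℕ) * ω ^ ((i : ℕ) * j))ᵀ)⁻¹ =
      Matrix.of fun i j : Fin n =>
        (n : K)⁻¹ * (φ⁻¹ ^ (j : ℕ) * ω ^ ((j : ℕ) * ((n - i) % n))) := by
  have hpos : 0 < n := Nat.pos_of_ne_zero (NeZero.ne n)
  have hprin : IsPrincipalRoot n ω := conv_isPrincipalRoot_of_isPrimitiveRoot hω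
  have aux : ∀ i : ℕ, i < n → (n - (n - i) % n) % n = i := by
    intro i hi
    rcases Nat.eq_zero_or_pos i with rfl | hi0
    · simp
    · rw [Nat.mod_eq_of_lt (by omega : n - i < n), Nat.sub_sub_self hi.le, Nat.mod_eq_of_lt hi]
  apply Matrix.inv_eq_left_inv
  ext i l
  simp only [Matrix.mul_apply, Matrix.of_apply, Matrix.transpose_apply, Matrix.one_apply]
  have step : ∀ j : Fin n, (n : K)⁻¹ * (φ⁻¹ ^ (j : ℕ) * ω ^ ((j : ℕ) * ((n - i) % n))) *
      (φ ^ (j : ℕ) * ω ^ ((l : ℕ) * j)) = (n : K)⁻¹ * ω ^ ((j : ℕ) * ((n - i) % n + l)) := by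
    intro j
    rw [inv_pow]
    field_simp
    ring
  simp_rw [step]
  rw [← Finset.mul_sum, Fin.sum_univ_eq_sum_range (fun j => ω ^ (j * ((n - i) % n + l))) n,
    hprin.sum_pow_mul]
  have key : ((n - (i : ℕ)) % n + l) % n = 0 ↔ i = l := by
    rw [add_mod_eq_zero_iff_eq_sub_mod (Nat.mod_lt _ hpos) l.isLt]
    constructor
    · intro h
      have h' := congrArg (fun x => (n - x) % n) h
      simp only [aux i i.isLt, aux l l.isLt] at h'
      exact Fin.ext h'
    · rintro rfl
      rfl
  by_cases hil : i = l
  · rw [if_pos (key.2 hil), if_pos hil, inv_mul_cancel₀ hn]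
  · rw [if_neg (mt key.1 hil), if_neg hil, mul_zero]

/-- A column of `V G` for the twisted DFT `V = (ε^j ω^{ij})` is a DFT of the weighted column.
[folklore] -/
theorem conv_twistedDFT_mul_apply {n : ℕ} {m : Type*} (ε ω : K) (G : Matrix (Fin n) m K) (i : Fin n)
    (c : m) :
    ((Matrix.of fun i j : Fin n => ε ^ (j : ℕ) * ω ^ ((i : ℕ) * j)) * G) i c =
      dft n ω (fun j => if h : j < n then ε ^ j * G ⟨j, h⟩ c else 0) i := by
  simp only [Matrix.mul_apply, Matrix.of_apply, dft]
  rw [Finset.sum_fin_eq_sum_range]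
  refine Finset.sum_congr rfl fun j hj => ?_
  rw [dif_pos (Finset.mem_range.1 hj), dif_pos (Finset.mem_range.1 hj)]
  ring

/-- A column of `W H` for the inverse transposed twisted DFT `W` is `n⁻¹` times a reversed DFT of
the weighted column. [folklore] -/
theorem conv_twistedDFTInv_mul_apply {n : ℕ} {m : Type*} (φ ω : K) (H : Matrix (Fin n) m K)
    (i : Fin n) (c : m) :
    ((Matrix.of fun i j : Fin n =>
        (n : K)⁻¹ * (φ⁻¹ ^ (j : ℕ) * ω ^ ((j : ℕ) * ((n - i) % n)))) * H) i c =
      (n : K)⁻¹ * dft n ω (fun j => if h : j < n then φ⁻¹ ^ j * H ⟨j, h⟩ c else 0)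
        ((n - i) % n) := by
  simp only [Matrix.mul_apply, Matrix.of_apply, dft, Finset.mul_sum]
  rw [Finset.sum_fin_eq_sum_range]
  refine Finset.sum_congr rfl fun j hj => ?_
  rw [dif_pos (Finset.mem_range.1 hj), dif_pos (Finset.mem_range.1 hj)]
  ring

/-- **From intertwining relations to a Cauchy-like matrix** (Heinig 1995; Pan 2001, Thm. 4.7.2):
if `D_x V = V Z_e`, `D_y W = W Z_f` with `W` invertible and `Z_e T - T Z_f = G Hᵀ`, then
`V T W⁻¹` is the Cauchy-like matrix with nodes `x, y` and generator `(V G, (Wᵀ)⁻¹ H)`.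
[cite: Pan2001, §4.7] -/
theorem conv_cauchyLike_eq_of_intertwining {ι κ' : Type*} [Fintype ι] [DecidableEq ι] [Fintype κ']
    {x y : ι → K} (hxy : ∀ i j, x i ≠ y j) {V W Ze Zf T : Matrix ι ι K} {G H : Matrix ι κ' K}
    (hV : Matrix.diagonal x * V = V * Ze) (hW : Matrix.diagonal y * W = W * Zf)
    (hWdet : IsUnit W.det) (hS : Ze * T - T * Zf = G * Hᵀ) :
    cauchyLike x y (V * G) ((Wᵀ)⁻¹ * H) = V * T * W⁻¹ := by
  symm
  apply eq_cauchyLike_of_displacement hxy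
  have hW' : W⁻¹ * Matrix.diagonal y = Zf * W⁻¹ := by
    calc W⁻¹ * Matrix.diagonal y = W⁻¹ * (Matrix.diagonal y * W) * W⁻¹ := by
          rw [Matrix.mul_assoc, Matrix.mul_assoc, Matrix.mul_nonsing_inv _ hWdet, Matrix.mul_one]
      _ = Zf * W⁻¹ := by
          rw [hW, ← Matrix.mul_assoc, Matrix.nonsing_inv_mul _ hWdet, Matrix.one_mul]
  have e1 : Matrix.diagonal x * (V * T * W⁻¹) = V * (Ze * T) * W⁻¹ := by
    rw [← Matrix.mul_assoc, ← Matrix.mul_assoc, hV]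
    simp only [Matrix.mul_assoc]
  have e2 : V * T * W⁻¹ * Matrix.diagonal y = V * (T * Zf) * W⁻¹ := by
    rw [Matrix.mul_assoc, hW']
    simp only [Matrix.mul_assoc]
  rw [e1, e2, ← Matrix.sub_mul, ← Matrix.mul_sub, hS, Matrix.transpose_mul,
    Matrix.transpose_nonsing_inv, Matrix.transpose_transpose]
  simp only [Matrix.mul_assoc]

end TwistedDFT

noncomputable section

section KLevel

variable {K : Type} [Field K] [Algebra ℂ K]

/-- **Cost of the two twisted DFTs** (Pan 2001, §4.7: the conversion costs `O(β)` FFTs): the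
entries of `V_ε G` and `(V_φᵀ)⁻¹ H` are obtained from those of `G, H` column by column by a
weighting, one FFT (`hfft`) and, for the inverse, a rescaling: `card m · (2κ+3) · 2^κ` steps.
[cite: Pan2001, §4.7] -/
theorem conv_cost_transforms
    (hfft : ∀ (κ : ℕ) (ω : ℂ) (a : ℕ → K) (A : Set K),
      (∀ i < 2 ^ κ, a i ∈ A ∪ Set.range (algebraMap ℂ K)) →
      Derivable ℂ (κ * 2 ^ κ) A {v | ∃ j < 2 ^ κ, v = fft κ (algebraMap ℂ K ω) a j})
    (κ : ℕ) {m : Type*} [Fintype m] (ω ε φ : ℂ) (hω : IsPrimitiveRoot ω (2 ^ κ)) (hφ : φ ≠ 0)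
    (B : Set K) (G H : Matrix (Fin (2 ^ κ)) m K)
    (hG : ∀ j c, G j c ∈ B ∪ Set.range (algebraMap ℂ K))
    (hH : ∀ j c, H j c ∈ B ∪ Set.range (algebraMap ℂ K)) :
    Derivable ℂ (Fintype.card m * ((2 * κ + 3) * 2 ^ κ)) B
      (Set.range (fun ik : Fin (2 ^ κ) × m => ((Matrix.of fun i j : Fin (2 ^ κ) =>
          algebraMap ℂ K ε ^ (j : ℕ) * algebraMap ℂ K ω ^ ((i : ℕ) * j)) * G) ik.1 ik.2) ∪
        Set.range (fun ik : Fin (2 ^ κ) × m => (((Matrix.of fun i j : Fin (2 ^ κ) =>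
          algebraMap ℂ K φ ^ (j : ℕ) * algebraMap ℂ K ω ^ ((i : ℕ) * j))ᵀ)⁻¹ * H) ik.1 ik.2)) := by
  have hnpos : 0 < 2 ^ κ := Nat.two_pow_pos κ
  have hinj : Function.Injective (algebraMap ℂ K) := (algebraMap ℂ K).injective
  set ωK := algebraMap ℂ K ω with hωK
  set εK := algebraMap ℂ K ε with hεK
  set φK := algebraMap ℂ K φ with hφK
  have hωK' : IsPrimitiveRoot ωK (2 ^ κ) := hω.map_of_injective hinj
  have hω2 : κ ≠ 0 → ωK ^ 2 ^ (κ - 1) = -1 := fun hκ =>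
    (hωK'.pow hnpos (conv_two_pow_eq κ hκ)).eq_neg_one_of_two_right
  have hnK : ((2 ^ κ : ℕ) : K) ≠ 0 := by
    rw [← map_natCast (algebraMap ℂ K), map_ne_zero]
    exact_mod_cast hnpos.ne'
  have hφK0 : φK ≠ 0 := (map_ne_zero _).2 hφ
  have hW := conv_twistedDFT_transpose_inv (n := 2 ^ κ) hφK0 hωK' hnK
  -- forward transforms, column by column
  have hV : ∀ c : m, Derivable ℂ (2 ^ κ + κ * 2 ^ κ) B
      {v | ∃ i < 2 ^ κ, v = fft κ ωK
        (fun j => if h : j < 2 ^ κ then εK ^ j * G ⟨j, h⟩ c else 0) i} := by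
    intro c
    have hw := Derivable.biUnion (k := ℂ) (Finset.univ : Finset (Fin (2 ^ κ)))
      fun j _ => Derivable.mul (A := B) (Or.inr ⟨ε ^ (j : ℕ), map_pow _ _ _⟩) (hG j c)
    rw [Finset.sum_const, Finset.card_univ, Fintype.card_fin, smul_eq_mul, mul_one] at hw
    refine hw.trans (hfft κ ω _ _ fun j hj => ?_)
    simp only [hj, dif_pos]
    exact Or.inl (Or.inr (Set.mem_iUnion₂.2 ⟨⟨j, hj⟩, Finset.mem_univ _, rfl⟩))
  -- inverse transposed transforms, column by column
  have hWc : ∀ c : m, Derivable ℂ (2 ^ κ + (κ * 2 ^ κ + 2 ^ κ)) B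
      (⋃ i ∈ (Finset.univ : Finset (Fin (2 ^ κ))), {((2 ^ κ : ℕ) : ℂ)⁻¹ • fft κ ωK
        (fun j => if h : j < 2 ^ κ then φK⁻¹ ^ j * H ⟨j, h⟩ c else 0) ((2 ^ κ - i) % 2 ^ κ)}) := by
    intro c
    have hw := Derivable.biUnion (k := ℂ) (Finset.univ : Finset (Fin (2 ^ κ)))
      fun j _ => Derivable.mul (A := B) (x := φK⁻¹ ^ (j : ℕ))
        (Or.inr ⟨φ⁻¹ ^ (j : ℕ), by rw [map_pow, map_inv₀]⟩) (hH j c)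
    rw [Finset.sum_const, Finset.card_univ, Fintype.card_fin, smul_eq_mul, mul_one] at hw
    have hf := hfft κ ω (fun j => if h : j < 2 ^ κ then φK⁻¹ ^ j * H ⟨j, h⟩ c else 0)
      (B ∪ ⋃ j ∈ (Finset.univ : Finset (Fin (2 ^ κ))), {φK⁻¹ ^ (j : ℕ) * H j c}) fun j hj => by
        simp only [hj, dif_pos]
        exact Or.inl (Or.inr (Set.mem_iUnion₂.2 ⟨⟨j, hj⟩, Finset.mem_univ _, rfl⟩))
    have hs := Derivable.biUnion (k := ℂ) (Finset.univ : Finset (Fin (2 ^ κ)))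
      fun i _ => Derivable.smul (k := ℂ)
        (A := B ∪ (⋃ j ∈ (Finset.univ : Finset (Fin (2 ^ κ))), {φK⁻¹ ^ (j : ℕ) * H j c}) ∪
          {v | ∃ i < 2 ^ κ, v = fft κ ωK
            (fun j => if h : j < 2 ^ κ then φK⁻¹ ^ j * H ⟨j, h⟩ c else 0) i})
        (Or.inl (Or.inr ⟨(2 ^ κ - i) % 2 ^ κ, Nat.mod_lt _ hnpos, rfl⟩)) ((2 ^ κ : ℕ) : ℂ)⁻¹
    rw [Finset.sum_const, Finset.card_univ, Fintype.card_fin, smul_eq_mul, mul_one] at hs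
    exact hw.trans (hf.trans hs)
  have hall := (Derivable.biUnion (Finset.univ : Finset m) fun c _ => hV c).union
    (Derivable.biUnion (Finset.univ : Finset m) fun c _ => hWc c)
  refine hall.mono (le_of_eq ?_) subset_rfl ?_
  · rw [Finset.sum_const, Finset.sum_const, Finset.card_univ, smul_eq_mul, smul_eq_mul]
    ring
  · rintro _ (⟨⟨i, c⟩, rfl⟩ | ⟨⟨i, c⟩, rfl⟩)
    · refine Or.inl (Set.mem_iUnion₂.2 ⟨c, Finset.mem_univ _, i, i.isLt, ?_⟩)
      dsimp only
      rw [conv_twistedDFT_mul_apply, fft_eq_dft κ ωK _ hω2 i i.isLt]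
    · refine Or.inr (Set.mem_iUnion₂.2 ⟨c, Finset.mem_univ _, Set.mem_iUnion₂.2
        ⟨i, Finset.mem_univ _, ?_⟩⟩)
      rw [Set.mem_singleton_iff]
      dsimp only
      rw [hW, conv_twistedDFTInv_mul_apply, fft_eq_dft κ ωK _ hω2 _ (Nat.mod_lt _ hnpos),
        Algebra.smul_def, map_inv₀, map_natCast]


end KLevel

end

end Summit.MatrixMultiplication.MatrixMultiplication.Theorems
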